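import Summits.BirchSwinnertonDyer.BirchSwinnertonDyer.Theorems.KolyvaginRoadThreeMethod2BipartiteFirstFloor
import Summits.BirchSwinnertonDyer.BirchSwinnertonDyer.Theorems.KolyvaginRoadThreeMethod2DefiniteFirstFloorDefs
import Summits.BirchSwinnertonDyer.BirchSwinnertonDyer.Theorems.KolyvaginRoadThreeMethod2Basics
import HarnessLib

/-!
# Route `KolyvaginRoadThree`, crux `ZhangSharpFrameAtThreeHL` (item stmt-BirchSwinnertonDyer-19574), stub S2-KS: THE DEFINITE
# CONDUCTOR-ONE COLUMN OF THE BIPARTITE DATUM OVER REAL OBJECTS — at every ODD good level the value `λ(∅, n′)` IS the Gross period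
# of the mod-3 Brandt eigenline along the conductor-1 CM orbit on the definite Shimura set `X_{N, ∏n′}`, and the three statements that
# consume it ((A⇐) at `m = ∅` = Jochnowitz reading, (B⇒) at `m = ∅` = first reciprocity law read on the period, (γ) = unit value at rank 0)
# are stated over the tree's Brandt-module vocabulary at ALL odd levels — koly g16's first floor (level `{q}`) run at every storey
# (cell `bsd-stepL`, seat `bsd-stepL-zhang3-w2` g0; `--supports stmt-BirchSwinnertonDyer-19574`, helper; companions p682024 ∕ p682864 ∕ p683235)

WHY. After the bipartite dictionary (`…LevelSystemsOfBipartite`, `…BipartiteFirstFloor`) stub S2-KS at a frame is ONE mod-3 bipartite datum: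
abstract even-level classes `κ₀(m, n)` with `realisation` and five local axioms, abstract odd-level values `λ(m, n′) ∈ 𝔽₃`, the laws
(A⇐) ∕ (B⇒) and the rank-0 anchor (γ). Of these, the CONDUCTOR-ONE COLUMN `m = ∅` of the DEFINITE side has REAL objects in the tree (koly g16,
`KolyvaginRoadThreeMethod2DefiniteFirstFloorDefs`, landed): for a Brandt setup `S : Brandt.XiSetup N (∏n′)` (definite quaternion algebra of
discriminant `∏n′` — it exists iff `#n′` is odd — with an Eichler order of level `N`), a mod-3 eigenline `φ` of `E` on its class set
(`IsModThreeEigenline W S φ`, anemic, with multiplicity one) and a conductor-1 Gross point `x₀ ∈ grossPoints K S 1`, W. Zhang's value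
`φ_{n′}(x_{n′}(1))` summed over `Pic(𝓞_K)` is `grossPeriod K S φ x₀ ∈ ℤ` ((6.1)–(6.2), Cor. 6.2). Hence the three consumers of `λ(∅, ·)`
are statements over real objects at EVERY odd good level `n′`, verbatim generalisations of koly g16's (DLR) ∕ (J′) ∕ (V′) from `{q}` to `n′`:
* (DLR∀) at every odd good `n′` there are `S`, `x₀ ∈ grossPoints K S 1`, `φ` with `IsModThreeEigenline W S φ` [Z14 Thm 2.1 + Lemma 3.3 ∕ (4.8)
  on the definite set at `p = 3`: bricks R2 + R6's multiplicity one];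
* (J∀) JOCHNOWITZ READING at every storey: for `n` even, `q ∉ n`, `n ∪ q` good, and EVERY `(S, x₀, φ)` at level `∏(n∪q)`: the even-level class
  `κ₀(∅, n)` is locally trivial above `q` iff `3 ∣ grossPeriod K S φ x₀` [Z14 (4.3) with Thm 3.1 (reduction of CM points `X_n → X_{nq}`) and
  (4.9) (Ihara): `loc_q c(1, n) = φ_{nq}(x_{nq,K})` up to a unit of `k₀ = 𝔽₃`; independence of `x₀`: `Pic(𝓞_K) × W` transitive on conductor-1
  Gross points, `φ̄` an Atkin–Lehner eigenvector; = (A⇐) AND its converse at `m = ∅`];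
* (B∅∀) FIRST RECIPROCITY LAW READ ON THE PERIOD: for `n′` odd, `q ∉ n′`, `n′ ∪ q` good, every `(S, x₀, φ)` at level `∏n′`: if the class
  `κ₀(∅, n′∪q)` is NOT locally trivial above `q` then `3 ∤ grossPeriod K S φ x₀` [Z14 (4.4)–(4.5): `loc_q c(1, n′q) ∈ H¹_ord(K_q, V) ≅ k` equals
  `φ_{n′}(x_{n′,K})` up to a unit (BD05 Thm 4.1 via Čerednik–Drinfeld); = (B⇒) at `m = ∅`];
* (V∀) UNIT VALUE AT RANK ZERO at every odd good `n′`: for every `(S, x₀, φ)` at level `∏n′`, `SelQ n′ ⊤ = ⊥ → SelQ n′ ⊥ = ⊥ →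
  3 ∤ grossPeriod K S φ x₀` [Z14 Thm 7.1 for `g_{n′}` over `K` (Skinner–Urban + Kato; at `p = 3 ∥ N`: R-SU3 + B♭) read through Gross's formula
  Cor. 6.2 + Thm 6.4 and Thm 5.2 — brick R7, the deep input; = (γ)].
With the value `λ(∅, n′) := [3 ∤ grossPeriod of the chosen (DLR∀)-datum]` the abstract laws at `m = ∅` and the anchor FOLLOW; the columns
`m ≠ ∅` (derived Gross values — no typed object yet) and the whole indefinite side stay abstract binders.

THIS FILE (theorems only; uses koly g16's DEFINITIONS `IsModThreeEigenline`, `grossPeriod`, no new definition):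
* `nonempty_levelKolyvaginSystem_of_bipartite_definiteColumn` — `Nonempty (LevelKolyvaginSystem W K Dt β ι c)` from: the abstract even-level
  datum (`ε₀`, `κ₀`, `realisation`, six local axioms), abstract values `λ′(m, n′)` with (A⇐)′ ∕ (B⇒)′ asked ONLY for `m ≠ ∅`, (A1) in binder form,
  and the four definite conductor-one statements (DLR∀) ∕ (J∀) ∕ (B∅∀) ∕ (V∀) over Brandt objects.
* `stub_levelKolyvaginSystemsAtThree_of_bipartite_definiteColumn` — S2-KS's registered text (frame hypotheses VERBATIM) from the same, with
  (A1) DISCHARGED (stub A) and `selmer_inf` DISCHARGED (imaginary quadratic `K`).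

THE PIN (inherited from koly g16's defs, module docstring there): `IsModThreeEigenline` is ANEMIC multiplicity one; it is the right object on
the locus where `ρ̄_{E,3}` has conductor exactly `N` (no congruent oldforms at the definite levels); off it (DLR∀) is uninhabited and the
theorems here are vacuous — there the statements want `U`-operators (definition-lane item). HONEST FRAMING: theorems only; 0 definitions,
0 named facts, 0 `sorry`; every definite statement and every abstract binder is a HYPOTHESIS; closes nothing (T7). PARTITION: O2@3 (B10) × A1 ×
crux 19574 × stub S2-KS — proves-glue (the `m = ∅` definite column of the residual typed over real objects). BSD is not proved by any of this.

References: [cite: WZhang2014, Thm. 2.1, §3.1, Thm. 3.1, Lemma 3.3, (4.3)–(4.5), (4.8)–(4.9), Cor. 6.2, Thm. 6.4, Thm. 6.5, Thm. 7.1,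
Thm. 7.2] [cite: BertoliniDarmon2005, Thm. 4.1, Thm. 4.2, Thm. 9.2] [cite: BertoliniDarmon1996, §2.1, §2.5] [cite: Gross1987, §3, §11].
-/

noncomputable section

open scoped Classical

namespace Summit.BirchSwinnertonDyer.Rank1Residual.X11b.Three.Koly.Method2Bipartite

open WeierstrassCurve NumberField IsDedekindDomain
  Literature.NumberTheory.EllipticCurves Literature.NumberTheory.EllipticCurves.ModularForms
  Literature.NumberTheory.GaloisRepresentations Literature.NumberTheory.Automorphic Module

open Summit.BirchSwinnertonDyer.Rank1Residual.X11b.Three.Koly.Method2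
open Summit.BirchSwinnertonDyer.Rank1Residual.X11b.Three.Koly.Method2DefiniteFirstFloor

section Abstract

variable (W : WeierstrassCurve ℚ) (K : Type) [Field K] [NumberField K]
  [W.IsElliptic] [W.IsGloballyMinimal] [NeZero (W.conductorNorm ℤ)]
  (Dt : ModularParametrizationData W (W.conductorNorm ℤ)) (β : ℤ) (ι : K →+* ℂ) (c : K ≃ₐ[ℚ] K)
  [Module (ZMod 3) (V3 W K)]

omit [W.IsElliptic] [NeZero (W.conductorNorm ℤ)] [Module (ZMod 3) (V3 W K)] in
/-- A unipotent-admissible prime has a place of `K` above it (`(q)` is a non-zero prime of `𝓞_K`: `q` is inert). [folklore] -/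
theorem exists_place_above (q : {q // IsUAdmissiblePrime W K q}) :
    ∃ v : HeightOneSpectrum (𝓞 K), ((q : ℕ) : 𝓞 K) ∈ v.asIdeal := by
  have hq3 : (Ideal.span {((q : ℕ) : 𝓞 K)}).IsPrime := q.2.2.2.2.2.1
  refine ⟨⟨Ideal.span {((q : ℕ) : 𝓞 K)}, hq3, ?_⟩, Ideal.mem_span_singleton_self _⟩
  rw [Ne, Ideal.span_singleton_eq_bot]
  exact_mod_cast q.2.1.ne_zero

/-- **A level Kolyvagin system at `p = 3` from a bipartite datum WHOSE DEFINITE CONDUCTOR-ONE COLUMN IS READ OVER BRANDT OBJECTS.**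
Inputs: the abstract even-level datum (`ε₀`, `κ₀` with `realisation` at `∅` and the six local axioms at even good non-empty levels);
abstract values `λ′(m, n′)` with the laws (A⇐)′ ∕ (B⇒)′ asked only for NON-EMPTY Kolyvagin conductors `m`; rank lowering (A1) in binder form;
and, over the tree's Brandt-module vocabulary at every odd good level, (DLR∀) a definite datum `(S, x₀, φ)`, (J∀) the Jochnowitz reading of
`κ₀(∅, n)` at a new prime `q` by the Gross period at level `n ∪ q`, (B∅∀) the first reciprocity law at `m = ∅` read on the period, (V∀) the
unit value at canonical rank zero. Construction: `λ(∅, n′) := 1` if `3 ∤ grossPeriod` of the (DLR∀)-datum chosen at `n′`, else `0`;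
`λ(m, n′) := λ′(m, n′)` for `m ≠ ∅`; then `nonempty_levelKolyvaginSystem_of_bipartite`. [cite: WZhang2014, (4.3)–(4.5), (4.9), Cor. 6.2,
Thm. 7.1, Thm. 7.2] [cite: BertoliniDarmon2005, Thm. 4.1, Thm. 4.2] -/
theorem nonempty_levelKolyvaginSystem_of_bipartite_definiteColumn
    (ε₀ : Finset {q // IsUAdmissiblePrime W K q} → Bool)
    (κ₀ : Finset {ℓ // Zhang2014.IsKolyvaginPrime (W.conductorNorm ℤ) W K 3 ℓ} →
      Finset {q // IsUAdmissiblePrime W K q} → V3 W K)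
    (lam' : Finset {ℓ // Zhang2014.IsKolyvaginPrime (W.conductorNorm ℤ) W K 3 ℓ} →
      Finset {q // IsUAdmissiblePrime W K q} → ZMod 3)
    (realisation : ∀ m : Finset {ℓ // Zhang2014.IsKolyvaginPrime (W.conductorNorm ℤ) W K 3 ℓ},
      ∃ d : KolyvaginHeegnerData Dt β ι (∏ ℓ ∈ m, (ℓ : ℕ)), κ₀ m ∅ = d.kolyvaginClass Nat.prime_three 1)
    (sign : ∀ n, GoodLevel W K n → n.Nonempty → Even n.card →
      ∀ m : Finset {ℓ // Zhang2014.IsKolyvaginPrime (W.conductorNorm ℤ) W K 3 ℓ},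
      conjAct W c ((3 ^ 1 : ℕ) : ℤ) (κ₀ m n) = sgn (ε₀ n ^^ Nat.bodd m.card) • κ₀ m n)
    (selmer_off : ∀ n, GoodLevel W K n → n.Nonempty → Even n.card →
      ∀ (m : Finset {ℓ // Zhang2014.IsKolyvaginPrime (W.conductorNorm ℤ) W K 3 ℓ}) (v : HeightOneSpectrum (𝓞 K)),
      (∀ ℓ ∈ m, ((ℓ : ℕ) : 𝓞 K) ∉ v.asIdeal) → (∀ q ∈ n, ((q : ℕ) : 𝓞 K) ∉ v.asIdeal) →
      κ₀ m n ∈ selmerLocalKer (W.baseChange K) (v.adicCompletion K) ((3 ^ 1 : ℕ) : ℤ))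
    (selmer_inf : ∀ n, GoodLevel W K n → n.Nonempty → Even n.card →
      ∀ (m : Finset {ℓ // Zhang2014.IsKolyvaginPrime (W.conductorNorm ℤ) W K 3 ℓ}) (w : InfinitePlace K),
      κ₀ m n ∈ selmerLocalKer (W.baseChange K) w.Completion ((3 ^ 1 : ℕ) : ℤ))
    (ordinary_on : ∀ n, GoodLevel W K n → n.Nonempty → Even n.card →
      ∀ m : Finset {ℓ // Zhang2014.IsKolyvaginPrime (W.conductorNorm ℤ) W K 3 ℓ}, ∀ q ∈ n, ∀ v : HeightOneSpectrum (𝓞 K),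
      ((q : ℕ) : 𝓞 K) ∈ v.asIdeal → κ₀ m n ∈ (W.baseChange K).ordinaryLocalKer (v.adicCompletion K) ((3 ^ 1 : ℕ) : ℤ))
    (transverse_on : ∀ n, GoodLevel W K n → n.Nonempty → Even n.card →
      ∀ m : Finset {ℓ // Zhang2014.IsKolyvaginPrime (W.conductorNorm ℤ) W K 3 ℓ}, ∀ ℓ ∈ m, ∀ v : HeightOneSpectrum (𝓞 K),
      ((ℓ : ℕ) : 𝓞 K) ∈ v.asIdeal → κ₀ m n ∈ transverseLocalKer W K ι ℓ v)
    (relation : ∀ n, GoodLevel W K n → n.Nonempty → Even n.card →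
      ∀ (m : Finset {ℓ // Zhang2014.IsKolyvaginPrime (W.conductorNorm ℤ) W K 3 ℓ})
        (ℓ : {ℓ // Zhang2014.IsKolyvaginPrime (W.conductorNorm ℤ) W K 3 ℓ}), ℓ ∉ m → ∀ v : HeightOneSpectrum (𝓞 K),
      ((ℓ : ℕ) : 𝓞 K) ∈ v.asIdeal →
      (κ₀ (insert ℓ m) n ∈ (W.baseChange K).torsionLocalKer (v.adicCompletion K) ((3 ^ 1 : ℕ) : ℤ) ↔
        κ₀ m n ∈ (W.baseChange K).torsionLocalKer (v.adicCompletion K) ((3 ^ 1 : ℕ) : ℤ)))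
    -- the laws for the DERIVED columns `m ≠ ∅` (abstract: derived Gross values have no typed object yet)
    (lawA' : ∀ (n : Finset {q // IsUAdmissiblePrime W K q}) (q : {q // IsUAdmissiblePrime W K q}),
      GoodLevel W K (insert q n) → Even n.card → q ∉ n →
      ∀ m : Finset {ℓ // Zhang2014.IsKolyvaginPrime (W.conductorNorm ℤ) W K 3 ℓ}, m.Nonempty →
      lam' m (insert q n) ≠ 0 → ∃ v : HeightOneSpectrum (𝓞 K), ((q : ℕ) : 𝓞 K) ∈ v.asIdeal ∧
        κ₀ m n ∉ (W.baseChange K).torsionLocalKer (v.adicCompletion K) ((3 ^ 1 : ℕ) : ℤ))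
    (lawB' : ∀ (n : Finset {q // IsUAdmissiblePrime W K q}) (q : {q // IsUAdmissiblePrime W K q}),
      GoodLevel W K (insert q n) → Odd n.card → q ∉ n →
      ∀ (m : Finset {ℓ // Zhang2014.IsKolyvaginPrime (W.conductorNorm ℤ) W K 3 ℓ}), m.Nonempty →
      ∀ (v : HeightOneSpectrum (𝓞 K)), ((q : ℕ) : 𝓞 K) ∈ v.asIdeal →
      κ₀ m (insert q n) ∉ (W.baseChange K).torsionLocalKer (v.adicCompletion K) ((3 ^ 1 : ℕ) : ℤ) → lam' m n ≠ 0)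
    (hA1 : ∀ (n : Finset {q // IsUAdmissiblePrime W K q}) (μ : Bool) (x : V3 W K),
      GoodLevel W K n → x ∈ SelQ W K c n μ → x ≠ 0 →
      ∃ q : {q // IsUAdmissiblePrime W K q}, q ∉ n ∧ GoodLevel W K (insert q n) ∧
        x ∉ SelQ W K c (insert q n) μ ∧
        SelQ W K c (insert q n) μ ≤ SelQ W K c n μ ∧
        finrank (ZMod 3) (SelQ W K c (insert q n) μ) + 1 = finrank (ZMod 3) (SelQ W K c n μ) ∧
        SelQ W K c (insert q n) (!μ) = SelQ W K c n (!μ))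
    -- (DLR∀) a definite datum at every odd good level
    (hDLR : ∀ n' : Finset {q // IsUAdmissiblePrime W K q}, GoodLevel W K n' → Odd n'.card →
      ∃ (S : Brandt.XiSetup (W.conductorNorm ℤ) (∏ q ∈ n', (q : ℕ))) (_ : Fintype (Brandt.ClassSet S.O))
        (x₀ : GrossSpace S.D K) (φ : Brandt.ClassSet S.O → ℤ), x₀ ∈ grossPoints K S 1 ∧ IsModThreeEigenline W S φ)
    -- (J∀) Jochnowitz reading of the even-level conductor-one class at a new prime, by the Gross period one level up
    (hJ : ∀ (n : Finset {q // IsUAdmissiblePrime W K q}) (q : {q // IsUAdmissiblePrime W K q}),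
      GoodLevel W K (insert q n) → Even n.card → q ∉ n →
      ∀ (S : Brandt.XiSetup (W.conductorNorm ℤ) (∏ q' ∈ insert q n, (q' : ℕ))) [Fintype (Brandt.ClassSet S.O)]
        (x₀ : GrossSpace S.D K) (φ : Brandt.ClassSet S.O → ℤ), x₀ ∈ grossPoints K S 1 → IsModThreeEigenline W S φ →
      ∀ v : HeightOneSpectrum (𝓞 K), ((q : ℕ) : 𝓞 K) ∈ v.asIdeal →
      (κ₀ ∅ n ∈ (W.baseChange K).torsionLocalKer (v.adicCompletion K) ((3 ^ 1 : ℕ) : ℤ) ↔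
        (3 : ℤ) ∣ grossPeriod K S φ x₀))
    -- (B∅∀) the first reciprocity law at `m = ∅`, read on the Gross period one level down
    (hB0 : ∀ (n' : Finset {q // IsUAdmissiblePrime W K q}) (q : {q // IsUAdmissiblePrime W K q}),
      GoodLevel W K (insert q n') → Odd n'.card → q ∉ n' →
      ∀ (S : Brandt.XiSetup (W.conductorNorm ℤ) (∏ q' ∈ n', (q' : ℕ))) [Fintype (Brandt.ClassSet S.O)]
        (x₀ : GrossSpace S.D K) (φ : Brandt.ClassSet S.O → ℤ), x₀ ∈ grossPoints K S 1 → IsModThreeEigenline W S φ →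
      ∀ v : HeightOneSpectrum (𝓞 K), ((q : ℕ) : 𝓞 K) ∈ v.asIdeal →
      κ₀ ∅ (insert q n') ∉ (W.baseChange K).torsionLocalKer (v.adicCompletion K) ((3 ^ 1 : ℕ) : ℤ) →
      ¬ (3 : ℤ) ∣ grossPeriod K S φ x₀)
    -- (V∀) unit value at canonical rank zero, at every odd good level
    (hV : ∀ n' : Finset {q // IsUAdmissiblePrime W K q}, GoodLevel W K n' → Odd n'.card →
      ∀ (S : Brandt.XiSetup (W.conductorNorm ℤ) (∏ q ∈ n', (q : ℕ))) [Fintype (Brandt.ClassSet S.O)]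
        (x₀ : GrossSpace S.D K) (φ : Brandt.ClassSet S.O → ℤ), x₀ ∈ grossPoints K S 1 → IsModThreeEigenline W S φ →
      SelQ W K c n' true = ⊥ → SelQ W K c n' false = ⊥ → ¬ (3 : ℤ) ∣ grossPeriod K S φ x₀) :
    Nonempty (LevelKolyvaginSystem W K Dt β ι c) := by
  classical
  -- the Gross period of the chosen definite datum at an odd good level (junk `0` elsewhere)
  let gp : Finset {q // IsUAdmissiblePrime W K q} → ℤ := fun n' ↦
    if h : GoodLevel W K n' ∧ Odd n'.card then
      grossPeriod K (hDLR n' h.1 h.2).choose (hDLR n' h.1 h.2).choose_spec.choose_spec.choose_spec.choose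
        (hDLR n' h.1 h.2).choose_spec.choose_spec.choose
    else 0
  -- KEY: at an odd good level, `3 ∤ gp n'` iff some (every) statement about the chosen datum says so
  have hgp : ∀ (n' : Finset {q // IsUAdmissiblePrime W K q}) (hg : GoodLevel W K n') (ho : Odd n'.card),
      ∃ (S : Brandt.XiSetup (W.conductorNorm ℤ) (∏ q ∈ n', (q : ℕ))) (_ : Fintype (Brandt.ClassSet S.O))
        (x₀ : GrossSpace S.D K) (φ : Brandt.ClassSet S.O → ℤ),
        x₀ ∈ grossPoints K S 1 ∧ IsModThreeEigenline W S φ ∧ gp n' = grossPeriod K S φ x₀ := by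
    intro n' hg ho
    have hE := hDLR n' hg ho
    refine ⟨hE.choose, hE.choose_spec.choose, hE.choose_spec.choose_spec.choose,
      hE.choose_spec.choose_spec.choose_spec.choose, hE.choose_spec.choose_spec.choose_spec.choose_spec.1,
      hE.choose_spec.choose_spec.choose_spec.choose_spec.2, ?_⟩
    exact dif_pos (And.intro hg ho)
  -- the values: conductor-one column from the Gross periods, derived columns abstract
  let lam : Finset {ℓ // Zhang2014.IsKolyvaginPrime (W.conductorNorm ℤ) W K 3 ℓ} →
      Finset {q // IsUAdmissiblePrime W K q} → ZMod 3 :=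
    fun m n' ↦ if m = ∅ then (if (3 : ℤ) ∣ gp n' then 0 else 1) else lam' m n'
  have hlam0 : ∀ n', lam ∅ n' ≠ 0 ↔ ¬ (3 : ℤ) ∣ gp n' := by
    intro n'
    simp only [lam, if_true]
    by_cases h : (3 : ℤ) ∣ gp n'
    · simp [h]
    · simp [h]
  have hlam' : ∀ {m} (_ : m ≠ ∅) (n'), lam m n' = lam' m n' := fun hm n' ↦ by simp only [lam, if_neg hm]
  refine nonempty_levelKolyvaginSystem_of_bipartite W K Dt β ι c ε₀ κ₀ lam realisation sign selmer_off selmer_inf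
    ordinary_on transverse_on relation ?_ ?_ hA1 ?_
  · -- (A⇐): at `m = ∅` the Jochnowitz reading of the chosen datum at the odd level `n ∪ q`; at `m ≠ ∅` abstract
    intro n q hgood he hqn m hne
    by_cases hm : m = ∅
    · subst hm
      have ho : Odd (insert q n).card := by rw [Finset.card_insert_of_notMem hqn]; exact he.add_one
      obtain ⟨S, inst, x₀, φ, hx₀, hφ, hgpeq⟩ := hgp (insert q n) hgood ho
      have h3 : ¬ (3 : ℤ) ∣ grossPeriod K S φ x₀ := by rw [← hgpeq]; exact (hlam0 _).mp hne
      obtain ⟨v, hv⟩ := exists_place_above W K q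
      exact ⟨v, hv, fun hmem ↦ h3 ((hJ n q hgood he hqn S x₀ φ hx₀ hφ v hv).mp hmem)⟩
    · exact lawA' n q hgood he hqn m (Finset.nonempty_iff_ne_empty.mpr hm) (by rwa [← hlam' hm])
  · -- (B⇒): at `m = ∅` the first law read on the period of the chosen datum at `n'`; at `m ≠ ∅` abstract
    intro n' q hgood ho hqn m v hv hdet
    by_cases hm : m = ∅
    · subst hm
      obtain ⟨S, inst, x₀, φ, hx₀, hφ, hgpeq⟩ := hgp n' ((goodLevel_insert_iff W K).mp hgood).2 ho
      exact (hlam0 n').mpr (hgpeq ▸ hB0 n' q hgood ho hqn S x₀ φ hx₀ hφ v hv hdet)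
    · rw [hlam' hm]
      exact lawB' n' q hgood ho hqn m (Finset.nonempty_iff_ne_empty.mpr hm) v hv hdet
  · -- (γ): unit value at canonical rank zero for the chosen datum
    intro n' hg ho h0
    obtain ⟨S, inst, x₀, φ, hx₀, hφ, hgpeq⟩ := hgp n' hg ho
    haveI := finiteDimensional_selQ W K c n' true
    haveI := finiteDimensional_selQ W K c n' false
    have ht : SelQ W K c n' true = ⊥ := Submodule.finrank_eq_zero.mp (by omega)
    have hf : SelQ W K c n' false = ⊥ := Submodule.finrank_eq_zero.mp (by omega)
    exact (hlam0 n').mpr (hgpeq ▸ hV n' hg ho S x₀ φ hx₀ hφ ht hf)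

end Abstract

/-- **Stub S2-KS's text from a bipartite datum WITH ITS DEFINITE CONDUCTOR-ONE COLUMN OVER BRANDT OBJECTS, (A1) and `selmer_inf`
DISCHARGED.** The registered hypotheses of `stub_levelKolyvaginSystemsAtThree` VERBATIM; then: the abstract even-level datum (`ε₀`, `κ₀`,
`realisation`, `sign`, `selmer_off`, `ordinary_on`, `transverse_on`, `relation`), abstract derived values `λ′` with (A⇐)′ ∕ (B⇒)′ for `m ≠ ∅`,
and over the tree's Brandt-module vocabulary at every odd good level: (DLR∀) definite data, (J∀) Jochnowitz readings, (B∅∀) the first law at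
`m = ∅` on the period, (V∀) the unit value at rank zero — give `Nonempty (LevelKolyvaginSystem W K Dt β ι c)`. (A1) = stub A (p489918);
`selmer_inf` by `mem_selmerLocalKer_infinitePlace_of_isImaginaryQuadratic`. At the one-prime levels (DLR∀) ∕ (J∀ at n = ∅) ∕ (V∀) are koly
g16's `DefiniteLevelRaisingAt` ∕ `JochnowitzAtThree` (for the realised datum) ∕ `DefiniteUnitValueAtThree`. [cite: WZhang2014, Thm. 2.1,
Thm. 3.1, (4.3)–(4.5), (4.8)–(4.9), Cor. 6.2, Thm. 6.4, Thm. 7.1, Thm. 7.2] [cite: BertoliniDarmon2005, Thm. 4.1, Thm. 4.2, Thm. 9.2] -/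
theorem stub_levelKolyvaginSystemsAtThree_of_bipartite_definiteColumn :
    ∀ (W : WeierstrassCurve ℚ) [W.IsElliptic] [W.IsGloballyMinimal] [NeZero (W.conductorNorm ℤ)] (K : Type)
      [Field K] [NumberField K] (Dt : ModularParametrizationData W (W.conductorNorm ℤ)) (β : ℤ) (ι : K →+* ℂ),
      Summit.BirchSwinnertonDyer.Rank1Residual.ClassX11b W 3 → W.HasMultiplicativeReductionAtPrime 3 →
      Rank1Residual.Surj W 3 → Rank1Residual.Ram W 3 → ¬ 3 ∣ W.tamagawaProduct → IsImaginaryQuadratic K →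
      Odd (NumberField.discr K) → SatisfiesHeegnerHypothesis (W.conductorNorm ℤ) K →
      (W.quadraticTwist (NumberField.discr K : ℚ)).entireLFunction 1 ≠ 0 → NumberField.discr K ≠ -3 →
      (4 * (W.conductorNorm ℤ : ℤ)) ∣ β ^ 2 - NumberField.discr K → ¬ (3 : ℤ) ∣ Dt.c →
      ∀ (c : K ≃ₐ[ℚ] K), c ≠ 1 → ∀ [Module (ZMod 3) (V3 W K)],
      ∀ (ε₀ : Finset {q // IsUAdmissiblePrime W K q} → Bool)
        (κ₀ : Finset {ℓ // Zhang2014.IsKolyvaginPrime (W.conductorNorm ℤ) W K 3 ℓ} →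
          Finset {q // IsUAdmissiblePrime W K q} → V3 W K)
        (lam' : Finset {ℓ // Zhang2014.IsKolyvaginPrime (W.conductorNorm ℤ) W K 3 ℓ} →
          Finset {q // IsUAdmissiblePrime W K q} → ZMod 3),
      -- realisation at `∅`
      (∀ m : Finset {ℓ // Zhang2014.IsKolyvaginPrime (W.conductorNorm ℤ) W K 3 ℓ},
        ∃ d : KolyvaginHeegnerData Dt β ι (∏ ℓ ∈ m, (ℓ : ℕ)), κ₀ m ∅ = d.kolyvaginClass Nat.prime_three 1) →
      -- sign
      (∀ n, GoodLevel W K n → n.Nonempty → Even n.card →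
        ∀ m : Finset {ℓ // Zhang2014.IsKolyvaginPrime (W.conductorNorm ℤ) W K 3 ℓ},
        conjAct W c ((3 ^ 1 : ℕ) : ℤ) (κ₀ m n) = sgn (ε₀ n ^^ Nat.bodd m.card) • κ₀ m n) →
      -- selmer_off
      (∀ n, GoodLevel W K n → n.Nonempty → Even n.card →
        ∀ (m : Finset {ℓ // Zhang2014.IsKolyvaginPrime (W.conductorNorm ℤ) W K 3 ℓ}) (v : HeightOneSpectrum (𝓞 K)),
        (∀ ℓ ∈ m, ((ℓ : ℕ) : 𝓞 K) ∉ v.asIdeal) → (∀ q ∈ n, ((q : ℕ) : 𝓞 K) ∉ v.asIdeal) →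
        κ₀ m n ∈ selmerLocalKer (W.baseChange K) (v.adicCompletion K) ((3 ^ 1 : ℕ) : ℤ)) →
      -- ordinary_on
      (∀ n, GoodLevel W K n → n.Nonempty → Even n.card →
        ∀ m : Finset {ℓ // Zhang2014.IsKolyvaginPrime (W.conductorNorm ℤ) W K 3 ℓ}, ∀ q ∈ n,
        ∀ v : HeightOneSpectrum (𝓞 K), ((q : ℕ) : 𝓞 K) ∈ v.asIdeal →
        κ₀ m n ∈ (W.baseChange K).ordinaryLocalKer (v.adicCompletion K) ((3 ^ 1 : ℕ) : ℤ)) →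
      -- transverse_on
      (∀ n, GoodLevel W K n → n.Nonempty → Even n.card →
        ∀ m : Finset {ℓ // Zhang2014.IsKolyvaginPrime (W.conductorNorm ℤ) W K 3 ℓ}, ∀ ℓ ∈ m,
        ∀ v : HeightOneSpectrum (𝓞 K), ((ℓ : ℕ) : 𝓞 K) ∈ v.asIdeal → κ₀ m n ∈ transverseLocalKer W K ι ℓ v) →
      -- relation (8.1)
      (∀ n, GoodLevel W K n → n.Nonempty → Even n.card →
        ∀ (m : Finset {ℓ // Zhang2014.IsKolyvaginPrime (W.conductorNorm ℤ) W K 3 ℓ})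
          (ℓ : {ℓ // Zhang2014.IsKolyvaginPrime (W.conductorNorm ℤ) W K 3 ℓ}), ℓ ∉ m → ∀ v : HeightOneSpectrum (𝓞 K),
        ((ℓ : ℕ) : 𝓞 K) ∈ v.asIdeal →
        (κ₀ (insert ℓ m) n ∈ (W.baseChange K).torsionLocalKer (v.adicCompletion K) ((3 ^ 1 : ℕ) : ℤ) ↔
          κ₀ m n ∈ (W.baseChange K).torsionLocalKer (v.adicCompletion K) ((3 ^ 1 : ℕ) : ℤ))) →
      -- (A⇐)′ for `m ≠ ∅`
      (∀ (n : Finset {q // IsUAdmissiblePrime W K q}) (q : {q // IsUAdmissiblePrime W K q}),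
        GoodLevel W K (insert q n) → Even n.card → q ∉ n →
        ∀ m : Finset {ℓ // Zhang2014.IsKolyvaginPrime (W.conductorNorm ℤ) W K 3 ℓ}, m.Nonempty →
        lam' m (insert q n) ≠ 0 → ∃ v : HeightOneSpectrum (𝓞 K), ((q : ℕ) : 𝓞 K) ∈ v.asIdeal ∧
          κ₀ m n ∉ (W.baseChange K).torsionLocalKer (v.adicCompletion K) ((3 ^ 1 : ℕ) : ℤ)) →
      -- (B⇒)′ for `m ≠ ∅`
      (∀ (n : Finset {q // IsUAdmissiblePrime W K q}) (q : {q // IsUAdmissiblePrime W K q}),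
        GoodLevel W K (insert q n) → Odd n.card → q ∉ n →
        ∀ (m : Finset {ℓ // Zhang2014.IsKolyvaginPrime (W.conductorNorm ℤ) W K 3 ℓ}), m.Nonempty →
        ∀ (v : HeightOneSpectrum (𝓞 K)), ((q : ℕ) : 𝓞 K) ∈ v.asIdeal →
        κ₀ m (insert q n) ∉ (W.baseChange K).torsionLocalKer (v.adicCompletion K) ((3 ^ 1 : ℕ) : ℤ) →
        lam' m n ≠ 0) →
      -- (DLR∀)
      (∀ n' : Finset {q // IsUAdmissiblePrime W K q}, GoodLevel W K n' → Odd n'.card →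
        ∃ (S : Brandt.XiSetup (W.conductorNorm ℤ) (∏ q ∈ n', (q : ℕ))) (_ : Fintype (Brandt.ClassSet S.O))
          (x₀ : GrossSpace S.D K) (φ : Brandt.ClassSet S.O → ℤ), x₀ ∈ grossPoints K S 1 ∧ IsModThreeEigenline W S φ) →
      -- (J∀)
      (∀ (n : Finset {q // IsUAdmissiblePrime W K q}) (q : {q // IsUAdmissiblePrime W K q}),
        GoodLevel W K (insert q n) → Even n.card → q ∉ n →
        ∀ (S : Brandt.XiSetup (W.conductorNorm ℤ) (∏ q' ∈ insert q n, (q' : ℕ))) [Fintype (Brandt.ClassSet S.O)]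
          (x₀ : GrossSpace S.D K) (φ : Brandt.ClassSet S.O → ℤ), x₀ ∈ grossPoints K S 1 → IsModThreeEigenline W S φ →
        ∀ v : HeightOneSpectrum (𝓞 K), ((q : ℕ) : 𝓞 K) ∈ v.asIdeal →
        (κ₀ ∅ n ∈ (W.baseChange K).torsionLocalKer (v.adicCompletion K) ((3 ^ 1 : ℕ) : ℤ) ↔
          (3 : ℤ) ∣ grossPeriod K S φ x₀)) →
      -- (B∅∀)
      (∀ (n' : Finset {q // IsUAdmissiblePrime W K q}) (q : {q // IsUAdmissiblePrime W K q}),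
        GoodLevel W K (insert q n') → Odd n'.card → q ∉ n' →
        ∀ (S : Brandt.XiSetup (W.conductorNorm ℤ) (∏ q' ∈ n', (q' : ℕ))) [Fintype (Brandt.ClassSet S.O)]
          (x₀ : GrossSpace S.D K) (φ : Brandt.ClassSet S.O → ℤ), x₀ ∈ grossPoints K S 1 → IsModThreeEigenline W S φ →
        ∀ v : HeightOneSpectrum (𝓞 K), ((q : ℕ) : 𝓞 K) ∈ v.asIdeal →
        κ₀ ∅ (insert q n') ∉ (W.baseChange K).torsionLocalKer (v.adicCompletion K) ((3 ^ 1 : ℕ) : ℤ) →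
        ¬ (3 : ℤ) ∣ grossPeriod K S φ x₀) →
      -- (V∀)
      (∀ n' : Finset {q // IsUAdmissiblePrime W K q}, GoodLevel W K n' → Odd n'.card →
        ∀ (S : Brandt.XiSetup (W.conductorNorm ℤ) (∏ q ∈ n', (q : ℕ))) [Fintype (Brandt.ClassSet S.O)]
          (x₀ : GrossSpace S.D K) (φ : Brandt.ClassSet S.O → ℤ), x₀ ∈ grossPoints K S 1 → IsModThreeEigenline W S φ →
        SelQ W K c n' true = ⊥ → SelQ W K c n' false = ⊥ → ¬ (3 : ℤ) ∣ grossPeriod K S φ x₀) →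
      Nonempty (LevelKolyvaginSystem W K Dt β ι c) := by
  intro W _ _ _ K _ _ Dt β ι hX hmult hsurj hram htam hK hodd hH hLt h3 hβ hc c hc1 _ ε₀ κ₀ lam' realisation sign
    selmer_off ordinary_on transverse_on relation lawA' lawB' hDLR hJ hB0 hV
  exact nonempty_levelKolyvaginSystem_of_bipartite_definiteColumn W K Dt β ι c ε₀ κ₀ lam' realisation sign selmer_off
    (fun n _ _ _ m w ↦ mem_selmerLocalKer_infinitePlace_of_isImaginaryQuadratic hK _ w (κ₀ m n))
    ordinary_on transverse_on relation lawA' lawB'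
    (Method2StubA.stub_levelRaisingAtThree W K Dt β ι hX hmult hsurj hram htam hK hodd hH hLt h3 hβ hc c hc1) hDLR hJ hB0 hV

end Summit.BirchSwinnertonDyer.Rank1Residual.X11b.Three.Koly.Method2Bipartite

end
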